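import Summits.QuantumFields.YangMills.Theorems.LangevinControlUVOSLegsFromFemtoAndGapStubAssemblySoftLegsJoint
import HarnessLib

/-!
# Route `LangevinControlUV`, crux `OSLegsFromFemtoAndGap` (stmt-QuantumFields-9367): statements of reshape r3 of line `dlr-collar-transfer`

Continuation of the route Defs file `LangevinControlUVOSLegsFromFemtoAndGapDefs.lean` (§0–§3) for the third reshape
of the skeleton `Cruxes/OSLegsFromFemtoAndGap/Lines/dlr_collar_transfer.lean` (continuation lead
`prover-line-stmt-QuantumFields-9367-c1-0`).  It lives in a separate file because the r3 statements are phrased in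
the vocabulary of the LANDED soft-assembly toolkits (`latticeDist`, `latticeDistStr`, `torusMomentStr`,
`wilsonTorusMean`, `coordPerm`, …), which import the Defs file.  NOTHING here is asserted: every `def … : Prop` is a
line statement some registered stub proves or consumes; none is a literature fact and none restates the crux.

Reshape r3 splits the XL stub `stub_assembly6` (`MomentBounds6 ∧ LowerBounds ∧ GapInUnits ⇒ PreOS`), of which the
joint soft legs (toolkit XV `softLegs_joint`), E2 (XXI), hermiticity (XXII) and coordinate permutations (XXIII) are
landed, into four worker-sized stubs along its remaining mathematics, and merges the two unstaffable
hypothesis-side stubs: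

* §4.1 `SoftBundle` — the export list of `softLegs_joint` VERBATIM plus two scheme demands (a coupling threshold
  `b₀ ≤ β_k` and an arbitrary growth demand `g (β_k) k ≤ L_k`); `Statement.stub_growth`: the joint soft legs can
  meet any such demand (re-run of toolkit XV with a larger `L_k`).
* §4.2 `Statement.stub_hypercubic` — along any soft bundle the limit family is invariant under every signed
  permutation of the coordinate axes on `⁰𝒮` (coordinate permutations are landed, toolkit XXIII; the time
  reflection costs `O(a_k)` by the plane-dependent one-step shifts of the reflected plaquette corners, absorbed by
  the shift-defect export; signed permutations = permutations ∘ axis reflections).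
* §4.3 `conn`, `Decay`, `RPPos`, `ConnCS` and the two CONTINUUM stubs: `Statement.stub_gap` (reflection
  positivity on positive-time tuples + translations ⇒ Cauchy–Schwarz for the connected OS form, and exponential
  decay of the diagonal connected OS form on a dense class ⇒ `HasMassGap`) and `Statement.stub_cluster`
  (the same decay + Cauchy–Schwarz + coordinate permutations ⇒ E4 in every spatial direction).
* §4.4 `Statement.stub_rope` — the LATTICE rope (Osterwalder–Seiler reflection positivity on the odd torus,
  translation invariance, log-convexity of `j ↦ ⟪τⱼX, τⱼX⟫`, the anchor from H3 at `J ∼ L_k/2`, and the growth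
  demand killing the species-dependent H3 constants): there are demands `(b₀, g)` and a rate `Δ > 0` such that
  along EVERY soft bundle meeting them the limit family satisfies `RPPos` and `Decay Δ`.
* §4.5 `Statement.stub_femto` — `stub_pin` and `stub_fcp6` merged (H1 ∧ H2 ∧ H3 ⇒ FBL6 ∧ FC2 ∧ FC3; implied by
  the two, `stub_femto_of`), still the engine-grade / typed-crux residue, not to be staffed.

Refs: blueprint `Cruxes/OSLegsFromFemtoAndGap/Lines/dlr-collar-transfer-rope-blueprint.md` §3; OsterwalderSeiler1978
§§2–3; GlimmJaffe1987 §6.1, §19.3; OsterwalderSchrader1973 §3 (E2, E4); JaffeWitten2000 §4.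
-/

set_option autoImplicit false

noncomputable section

open scoped SchwartzMap ComplexConjugate
open MeasureTheory Filter Topology
open Literature.MathematicalPhysics.QuantumFieldTheory Literature.MathematicalPhysics.QuantumLattice
open Literature.MathematicalPhysics.AQFT
open Literature.Probability.LatticeModels (box Site)
open Summit.QuantumFields.YangMills.Theorems.OSLegsFromFemtoAndGap (latticeDist latticeDistStr torusMomentStr)

namespace Summit.QuantumFields.YangMills.Cruxes.OSLegsFromFemtoAndGap.DlrCollarTransfer

local notation "E4" => EuclideanSpace ℝ (Fin 4)

/-! ## §4.1 The soft bundle and the growth stub -/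

section Bundle

variable (G : Type) [Group G] [TopologicalSpace G] [IsTopologicalGroup G] [CompactSpace G]
  [MeasurableSpace G] [BorelSpace G] (r : LatticeRep G) (a : ℝ → ℝ)

/-- **The soft bundle** along a scheme `sch` with one-field limit `S₁`, plane-string limits `Tq` and a-uniform
constant `K`: the conclusion of toolkit XV `softLegs_joint` VERBATIM (units, renormalisations, `β_k → ∞`, E0,
E0′, E3, translations, `S₁ 0`/`S₁ 1`, convergence of the centred density distributions on `⁰𝒮`, the uniform
bound, the `IsYangMillsFor` clause for the curvature species, non-triviality, non-Gaussianity, the lattice gap,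
the scheme ranges, the a-uniform bound and the shift-defect bound for all plane strings, the per-string limits and
`S₁ = Σ_q Tq`), followed by the two r3 scheme demands `b₀ ≤ β_k` and `g (β_k) k ≤ L_k`. -/
def SoftBundle (sch : SpeciesScheme (YMSpecies G)) (S₁ : SchwingerFamily E4)
    (Tq : (n : ℕ) → (Fin n → Fin 4 × Fin 4) → (𝓢((Fin n → E4), ℂ) →L[ℂ] ℂ)) (K : ℝ)
    (b₀ : ℝ) (g : ℝ → ℕ → ℕ) : Prop :=
  ((∀ k, sch.a k = a (sch.β k)) ∧
      (∀ s k, sch.c s k = ((sch.a k)⁻¹) ^ 4) ∧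
      (∀ s k, sch.m s k = wilsonTorusMean r.ρ (sch.β k) (sch.L k) s.F) ∧
      Tendsto sch.β atTop atTop ∧
      S₁.toLabelled.IsNormalized ∧ S₁.toLabelled.HasLinearGrowth ∧ S₁.toLabelled.IsSymmetric ∧
      (∀ (n : ℕ) (t : E4) (F : 𝓢((Fin n → E4), ℂ)), IsOffDiagonal F → S₁ n (translateMulti t F) = S₁ n F) ∧
      (∀ F : 𝓢((Fin 0 → E4), ℂ), S₁ 0 F = F default) ∧ (∀ F : 𝓢((Fin 1 → E4), ℂ), S₁ 1 F = 0) ∧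
      (∀ n : ℕ, 2 ≤ n → ∀ F : 𝓢((Fin n → E4), ℂ), IsOffDiagonal F →
        Tendsto (fun k => latticeDist r.ρ (sch.β k) (sch.L k) (sch.a k) r.curvature.F
          (wilsonTorusMean r.ρ (sch.β k) (sch.L k) r.curvature.F) n F) atTop (𝓝 (S₁ n F))) ∧
      (0 ≤ K ∧ ∀ (n : ℕ) (F : 𝓢((Fin n → E4), ℂ)), ‖S₁ n F‖ ≤ 5 * (6 * K) ^ n * schwartzNorm (10 * n) F) ∧
      (∀ n : ℕ, n ≠ 0 → ∀ (f : Fin n → 𝓢(E4, ℝ)) (F : 𝓢((Fin n → E4), ℂ)),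
        IsTensorOf F (fun i => ofRealTest (f i)) → IsOffDiagonal F →
          Tendsto (fun k : ℕ => ((latticeSchwinger r.ρ sch (fun s => s.F) k n (fun _ => r.curvature) f : ℝ) : ℂ))
            atTop (𝓝 (S₁ n F))) ∧
      (∃ (F₁ G₁ : 𝓢((Fin 1 → E4), ℂ)) (H₁ : 𝓢((Fin (1 + 1) → E4), ℂ)),
        IsTimeOrdered F₁ ∧ IsTimeOrdered G₁ ∧ IsAppendTensorOf H₁ (osAdjoint F₁) G₁ ∧
          S₁.toLabelled (1 + 1) (fun _ => ()) H₁ ≠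
            S₁.toLabelled 1 (fun _ => ()) (osAdjoint F₁) * S₁.toLabelled 1 (fun _ => ()) G₁) ∧
      (∃ (f g h : 𝓢(E4, ℂ)) (Ffgh : 𝓢((Fin 3 → E4), ℂ)) (Fgh Ffh Ffg : 𝓢((Fin 2 → E4), ℂ))
        (Ff Fg Fh : 𝓢((Fin 1 → E4), ℂ)),
        IsTensorOf Ffgh ![f, g, h] ∧ IsOffDiagonal Ffgh ∧ IsTensorOf Fgh ![g, h] ∧
        IsTensorOf Ffh ![f, h] ∧ IsTensorOf Ffg ![f, g] ∧ IsTensorOf Ff ![f] ∧ IsTensorOf Fg ![g] ∧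
        IsTensorOf Fh ![h] ∧
          S₁.toLabelled 3 (fun _ => ()) Ffgh - S₁.toLabelled 1 (fun _ => ()) Ff * S₁.toLabelled 2 (fun _ => ()) Fgh -
            S₁.toLabelled 1 (fun _ => ()) Fg * S₁.toLabelled 2 (fun _ => ()) Ffh -
            S₁.toLabelled 1 (fun _ => ()) Fh * S₁.toLabelled 2 (fun _ => ()) Ffg +
            2 * (S₁.toLabelled 1 (fun _ => ()) Ff * S₁.toLabelled 1 (fun _ => ()) Fg *
              S₁.toLabelled 1 (fun _ => ()) Fh) ≠ 0) ∧
      (∃ Δ : ℝ, 0 < Δ ∧ HasLatticeMassGap r sch Δ) ∧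
      (∀ k, 0 ≤ sch.β k ∧ sch.a k ≤ 1 / 24 ∧ 14 ≤ sch.L k ∧ (sch.a k)⁻¹ * (sch.a k)⁻¹ ≤ sch.L k) ∧
      (∀ (k n : ℕ), 2 ≤ n → ∀ q : Fin n → Fin 4 × Fin 4, (∀ i, (q i).1 < (q i).2) →
        ∀ F : 𝓢((Fin n → E4), ℂ), IsOffDiagonal F →
        ∀ y : (Fin n → Site 4) → (Fin n → E4), (∀ x l, ‖y x l - sch.a k • siteToE (x l)‖ ≤ 6 * sch.a k) →
          ‖∑ x ∈ Fintype.piFinset (fun _ : Fin n => box 4 (sch.L k)),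
              ((torusMomentStr r.ρ (sch.β k) (sch.L k) (fun i U => plaquetteObs r.ρ 0 (q i).1 (q i).2 U)
                (fun i => wilsonTorusMean r.ρ (sch.β k) (sch.L k) (fun U => plaquetteObs r.ρ 0 (q i).1 (q i).2 U)) x : ℝ) : ℂ) *
              F (y x)‖ ≤
            K ^ n * (SchwartzMap.seminorm ℂ 0 (4 * n) F + SchwartzMap.seminorm ℂ (6 * n) (4 * n) F +
              SchwartzMap.seminorm ℂ 0 0 F + SchwartzMap.seminorm ℂ (6 * n) 0 F +
              SchwartzMap.seminorm ℂ (10 * n) 0 F)) ∧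
      (∀ (k n : ℕ), 2 ≤ n → ∀ q : Fin n → Fin 4 × Fin 4, (∀ i, (q i).1 < (q i).2) →
        ∀ F : 𝓢((Fin n → E4), ℂ), IsOffDiagonal F → ∀ c : Fin n → E4, (∀ l, ‖c l‖ ≤ sch.a k) →
          ‖∑ x ∈ Fintype.piFinset (fun _ : Fin n => box 4 (sch.L k)),
              ((torusMomentStr r.ρ (sch.β k) (sch.L k) (fun i U => plaquetteObs r.ρ 0 (q i).1 (q i).2 U)
                (fun i => wilsonTorusMean r.ρ (sch.β k) (sch.L k) (fun U => plaquetteObs r.ρ 0 (q i).1 (q i).2 U)) x : ℝ) : ℂ) *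
              (F ((fun l => sch.a k • siteToE (x l)) + c) - F (fun l => sch.a k • siteToE (x l)))‖ ≤
            2 * ‖c‖ * K ^ n * (SchwartzMap.seminorm ℂ 0 (4 * n + 1) F + SchwartzMap.seminorm ℂ (6 * n) (4 * n + 1) F +
              SchwartzMap.seminorm ℂ 0 1 F + SchwartzMap.seminorm ℂ (6 * n) 1 F + SchwartzMap.seminorm ℂ (10 * n) 1 F)) ∧
      (∀ n : ℕ, 2 ≤ n → ∀ q : Fin n → Fin 4 × Fin 4, (∀ i, (q i).1 < (q i).2) →
        ∀ F : 𝓢((Fin n → E4), ℂ), IsOffDiagonal F →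
          Tendsto (fun k => latticeDistStr r.ρ (sch.β k) (sch.L k) (sch.a k)
            (fun i U => plaquetteObs r.ρ 0 (q i).1 (q i).2 U)
            (fun i => wilsonTorusMean r.ρ (sch.β k) (sch.L k) (fun U => plaquetteObs r.ρ 0 (q i).1 (q i).2 U)) F)
            atTop (𝓝 (Tq n q F))) ∧
      (∀ n : ℕ, 2 ≤ n → ∀ F : 𝓢((Fin n → E4), ℂ),
        S₁ n F = ∑ q ∈ Fintype.piFinset (fun _ : Fin n => Finset.univ.filter fun p : Fin 4 × Fin 4 => p.1 < p.2),
          Tq n q F)) ∧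
    (∀ k, b₀ ≤ sch.β k ∧ g (sch.β k) k ≤ sch.L k)

end Bundle

/-- **Statement of `stub_growth`** — the joint soft legs along a scheme meeting, in addition, a coupling threshold
`b₀ ≤ β_k` and an ARBITRARY growth demand `g (β_k) k ≤ L_k` on the torus sides (toolkit XV re-run with
`β_k ≥ max(…, b₀)` and `L_k ≥ max(…, max_{i ≤ k} g β_k i)`; the subsequence `φ j ≥ j` of the compactness step keeps
the demand because the running maximum is monotone in the index).  The rope feeds it `b₀ = β₂` and
`g β k = max (S₁ β) (growth β k)` from H3. -/
def Statement.stub_growth : Prop :=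
  ∀ (G : Type) [Group G] [TopologicalSpace G] [IsTopologicalGroup G] [CompactSpace G]
    [MeasurableSpace G] [BorelSpace G] (r : LatticeRep G) (a : ℝ → ℝ),
    (∀ β, 0 < a β) → Tendsto a atTop (𝓝 0) →
      MomentBounds6 G r a → LowerBounds G r a → GapInUnits G r a →
        ∀ (b₀ : ℝ) (g : ℝ → ℕ → ℕ),
          ∃ (sch : SpeciesScheme (YMSpecies G)) (S₁ : SchwingerFamily E4)
            (Tq : (n : ℕ) → (Fin n → Fin 4 × Fin 4) → (𝓢((Fin n → E4), ℂ) →L[ℂ] ℂ)) (K : ℝ),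
            SoftBundle G r a sch S₁ Tq K b₀ g

/-! ## §4.2 Signed permutations of the axes -/

/-- **Statement of `stub_hypercubic`** — along any soft bundle, the limit family is invariant on `⁰𝒮` under every
linear isometry permuting the coordinate axes up to signs (all of the hyperoctahedral group, in particular the
det-1 ones of `PreOS`).  Coordinate permutations: toolkit XXIII (`softLimit_linActMulti_coordPerm`, exact on the
lattice).  Time reflection `timeReflection 4`: the torus state is reflection invariant
(`wilsonMeasure_map_timeReflect`) and the plane fields obey `plane q x (lift ΘU) = plane q (θ̃_q x) (lift U)` with
`θ̃_q x = θx − [q temporal] e₀` (toolkit XVII), so `latticeDistStr^q (ΘF) − latticeDistStr^q (F)` is a shift defect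
with `‖c_l‖ ≤ a_k` (bundle export) for compactly supported `F` once `a_k L_k` exceeds the support, and general
`F ∈ ⁰𝒮` follow by density (`exists_tsupport_subset_inter_closedBall_tendsto`) and continuity of `S₁ n`; a signed
permutation is a coordinate permutation composed with axis reflections `P_{(0 i)} Θ P_{(0 i)}`. -/
def Statement.stub_hypercubic : Prop :=
  ∀ (G : Type) [Group G] [TopologicalSpace G] [IsTopologicalGroup G] [CompactSpace G]
    [MeasurableSpace G] [BorelSpace G] (r : LatticeRep G) (a : ℝ → ℝ)
    (sch : SpeciesScheme (YMSpecies G)) (S₁ : SchwingerFamily E4)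
    (Tq : (n : ℕ) → (Fin n → Fin 4 × Fin 4) → (𝓢((Fin n → E4), ℂ) →L[ℂ] ℂ)) (K : ℝ) (b₀ : ℝ) (g : ℝ → ℕ → ℕ),
    SoftBundle G r a sch S₁ Tq K b₀ g →
      ∀ (n : ℕ) (R : E4 ≃ₗᵢ[ℝ] E4),
        (∀ i : Fin 4, ∃ j : Fin 4, R (EuclideanSpace.single i 1) = EuclideanSpace.single j 1 ∨
          R (EuclideanSpace.single i 1) = -EuclideanSpace.single j 1) →
        ∀ F : 𝓢((Fin n → E4), ℂ), IsOffDiagonal F → S₁ n (linActMulti R F) = S₁ n F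

/-! ## §4.3 The connected OS form of a one-field family: decay, positivity, the two continuum stubs -/

section Continuum

/-- **The connected (vacuum-subtracted) OS form** of a one-field family: `conn F G = S(ΘF* ⊗ G) − S(ΘF*) S(G)` —
the truncation of `HasMassGap` / E4 with the concrete tensor witness `appendTensor`. -/
def conn (S₁ : SchwingerFamily E4) {n m : ℕ} (F : 𝓢((Fin n → E4), ℂ)) (G : 𝓢((Fin m → E4), ℂ)) : ℂ :=
  S₁ (n + m) ((osAdjoint F).appendTensor G) - S₁ n (osAdjoint F) * S₁ m G

/-- **Exponential decay of the diagonal connected OS form on the dense class** (the output of the rope): for every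
real, off-diagonal, compactly supported test function `F` supported at positive times and every `t ≥ 0`,
`Re conn(F, T_{t e₀} F) ≤ Re conn(F, F) · e^{−Δ t}` — `‖e^{−tH/2} ψ_F‖² ≤ e^{−Δt} ‖ψ_F‖²` for the
vacuum-orthogonal part `ψ_F` of the OS vector of `F`. -/
def Decay (S₁ : SchwingerFamily E4) (Δ : ℝ) : Prop :=
  ∀ (n : ℕ) (F : 𝓢((Fin n → E4), ℂ)), IsOffDiagonal F → IsPositiveTimeMulti F →
    HasCompactSupport (F : (Fin n → E4) → ℂ) → (∀ u, conj (F u) = F u) →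
      ∀ t : ℝ, 0 ≤ t →
        (conn S₁ F (translateMulti (EuclideanSpace.single 0 t) F)).re ≤ (conn S₁ F F).re * Real.exp (-(Δ * t))

/-- **Reflection positivity on positive-time tuples** (`RPPos`): E2 for finite tuples of OFF-DIAGONAL test
functions supported at POSITIVE times (not necessarily time-ordered) — what Osterwalder–Seiler positivity of the
lattice gives (the smeared lattice field of such a function lives on the positive half of the odd torus), and what
the E4 argument needs after permuting a spatial axis into the time slot.  Implies `IsReflectionPositive`. -/
def RPPos (S₁ : SchwingerFamily E4) : Prop :=
  ∀ (N : ℕ) (deg : Fin N → ℕ) (F : (j : Fin N) → 𝓢((Fin (deg j) → E4), ℂ)),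
    (∀ j, IsPositiveTimeMulti (F j)) → (∀ j, IsOffDiagonal (F j)) →
      ∀ H : (i j : Fin N) → 𝓢((Fin (deg i + deg j) → E4), ℂ),
        (∀ i j, IsAppendTensorOf (H i j) (osAdjoint (F i)) (F j)) →
          let z := ∑ i, ∑ j, S₁ (deg i + deg j) (H i j)
          0 ≤ z.re ∧ z.im = 0

/-- **Cauchy–Schwarz for the connected OS form** (`ConnCS`) on positive-time off-diagonal test functions of any two
arities: `conn(F, F)` is real non-negative and `‖conn(F, G)‖² ≤ conn(F, F) conn(G, G)` (Schur complement of the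
positive `3 × 3` OS matrix of the tuple `(c·𝟙₀, F, G)`). -/
def ConnCS (S₁ : SchwingerFamily E4) : Prop :=
  ∀ (n m : ℕ) (F : 𝓢((Fin n → E4), ℂ)) (G : 𝓢((Fin m → E4), ℂ)),
    IsPositiveTimeMulti F → IsOffDiagonal F → IsPositiveTimeMulti G → IsOffDiagonal G →
      0 ≤ (conn S₁ F F).re ∧ (conn S₁ F F).im = 0 ∧
        ‖conn S₁ F G‖ ^ 2 ≤ (conn S₁ F F).re * (conn S₁ G G).re

/-- **Statement of `stub_gap`** — the continuum half of the mass gap: for a one-field family with `RPPos`,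
normalisation `S₁ 0 = ev`, translation invariance on `⁰𝒮`: (i) `ConnCS`; (ii) for every `Δ > 0`, `Decay Δ`
implies `HasMassGap Δ` — `conn(F, T_t G) = conn(T_{t/2}F, T_{t/2}G)` (translations), Cauchy–Schwarz, `Decay` on the
dense class, and density of compactly supported time-ordered functions (`exists_tsupport_subset_inter_closedBall_tendsto`)
with the contraction `Re conn(T_sF, T_sF) ≤ Re conn(F, F)` and real/imaginary parts `(F ± starTest F)/2`. -/
def Statement.stub_gap : Prop :=
  ∀ (S₁ : SchwingerFamily E4), (∀ F : 𝓢((Fin 0 → E4), ℂ), S₁ 0 F = F default) →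
    (∀ (n : ℕ) (t : E4) (F : 𝓢((Fin n → E4), ℂ)), IsOffDiagonal F → S₁ n (translateMulti t F) = S₁ n F) →
      RPPos S₁ →
        ConnCS S₁ ∧ ∀ Δ : ℝ, 0 < Δ → Decay S₁ Δ → S₁.toLabelled.HasMassGap Δ

/-- **Statement of `stub_cluster`** — E4 from the decay: for a one-field family with normalisation, translation
invariance and signed-permutation invariance on `⁰𝒮` (output of `stub_hypercubic`; only the transpositions
`x⁰ ↔ xⁱ` and the time reflection are used), `ConnCS` and `Decay Δ` (`Δ > 0`), the cluster property holds in every spatial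
direction `a⃗`: permute the axis of the largest component of `a⃗` into the time slot (toolkit XXIII `coordPerm`), shift compactly supported approximants into the positive half (translations), bound
`|conn(A, T_{s e₀ + b⊥} B)| ≤ (Re conn(A, T_sA) · Re conn(B, T_sB))^{1/2}` (transverse translations are exact symmetries,
Cauchy–Schwarz, `Decay`), and pass to general time-ordered `F, G` by `ConnCS` in the time direction (spatial
translations are `conn`-isometries) and density. -/
def Statement.stub_cluster : Prop :=
  ∀ (S₁ : SchwingerFamily E4) (Δ : ℝ), 0 < Δ → (∀ F : 𝓢((Fin 0 → E4), ℂ), S₁ 0 F = F default) →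
    (∀ F : 𝓢((Fin 1 → E4), ℂ), S₁ 1 F = 0) →
    (∀ (n : ℕ) (t : E4) (F : 𝓢((Fin n → E4), ℂ)), IsOffDiagonal F → S₁ n (translateMulti t F) = S₁ n F) →
    (∀ (n : ℕ) (R : E4 ≃ₗᵢ[ℝ] E4),
      (∀ i : Fin 4, ∃ j : Fin 4, R (EuclideanSpace.single i 1) = EuclideanSpace.single j 1 ∨
        R (EuclideanSpace.single i 1) = -EuclideanSpace.single j 1) →
      ∀ F : 𝓢((Fin n → E4), ℂ), IsOffDiagonal F → S₁ n (linActMulti R F) = S₁ n F) →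
      ConnCS S₁ → Decay S₁ Δ → S₁.toLabelled.HasClusterProperty

end Continuum

/-! ## §4.4 The lattice rope -/

/-- **Statement of `stub_rope`** — the reflection-positivity rope on the lattice.  From `a > 0`, `a → 0` and H3
alone there are scheme demands `(b₀, g)` and a rate `Δ > 0` (namely `b₀ = β₂`, `g` = H3's volume threshold `S₁(β)`
joined with the growth `⌈k a⁻¹ (1 + log⁺ (max of the H3 constants of the plane-string pairs of length ≤ 2k in the
ball of radius k/a) + log a⁻¹)⌉`, `Δ = c₁`) such that along EVERY soft bundle meeting them the limit family is
reflection positive on positive-time tuples (`RPPos`, Osterwalder–Seiler positivity of the odd torus through the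
landed square expansion, toolkits XVII–XXI) and its diagonal connected OS form decays at rate `Δ` on the dense class
(`Decay`): `h_k(j) = ⟪τⱼX, τⱼX⟫ − (EX)²` for the centred smeared field `X` of `F` is non-negative and log-convex in
`j` (reflection positivity + translation invariance + Cauchy–Schwarz), anchored by H3 at `J_k ∼ L_k/2`
(`h_k(J_k) ≤ D_k e^{−2c₁ a_k J_k}`, `D_k` = smearing mass² × the H3 constants of finitely many species pairs), so
`h_k(j) ≤ h_k(0)^{1−j/J_k} D_k^{j/J_k} e^{−2 c₁ a_k j}`; the growth demand gives `D_k^{j_k/J_k} → 1` for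
`j_k = ⌊t/2a_k⌋`, and `h_k(j_k) → Re conn(F, T_tF)`, `h_k(0) → Re conn(F, F)` by the landed limit machinery. -/
def Statement.stub_rope : Prop :=
  ∀ (G : Type) [Group G] [TopologicalSpace G] [IsTopologicalGroup G] [CompactSpace G]
    [MeasurableSpace G] [BorelSpace G] (r : LatticeRep G) (a : ℝ → ℝ),
    (∀ β, 0 < a β) → Tendsto a atTop (𝓝 0) → GapInUnits G r a →
      ∃ (b₀ : ℝ) (g : ℝ → ℕ → ℕ) (Δ : ℝ), 0 < Δ ∧
        ∀ (sch : SpeciesScheme (YMSpecies G)) (S₁ : SchwingerFamily E4)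
          (Tq : (n : ℕ) → (Fin n → Fin 4 × Fin 4) → (𝓢((Fin n → E4), ℂ) →L[ℂ] ℂ)) (K : ℝ),
          SoftBundle G r a sch S₁ Tq K b₀ g → RPPos S₁ ∧ Decay S₁ Δ

/-! ## §4.5 The merged hypothesis-side stub -/

/-- **Statement of `stub_femto`** — `stub_pin` and `stub_fcp6` merged: for every unit map meeting H1 and H3, the
periodic femto packages H1 ∧ H2 upgrade to the plane-resolved frozen-boundary femto package `FBL6 ∧ FC2 ∧ FC3`.
Implied by `Statement.stub_pin ∧ Statement.stub_fcp6` (`stub_femto_of`); inherits the typed-crux residue of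
`stub_pin` (Disproof §6/§8: doubtful exactly where the crux is, provable under the tenure repair `Continuous a`)
and the engine-grade content of `stub_fcp6`.  NOT to be staffed. -/
def Statement.stub_femto : Prop :=
  ∀ (G : Type) [Group G] [TopologicalSpace G] [IsTopologicalGroup G] [CompactSpace G]
    [MeasurableSpace G] [BorelSpace G], IsCompactSimpleLieGroup G →
    ∀ (r : LatticeRep G) (a : ℝ → ℝ), TwoPoint G r a → Skewness G r a → GapInUnits G r a →
      FBL6 G r a ∧ FC2 G r a ∧ FC3 G r a

/-- `stub_pin ∧ stub_fcp6 ⇒ stub_femto`. -/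
theorem stub_femto_of (hpin : Statement.stub_pin) (hfcp : Statement.stub_fcp6) : Statement.stub_femto :=
  fun G _ _ _ _ _ _ hG r a h1 h2 h3 => hfcp G hG r a (hpin G hG r a h1 h3) h2

/-- `RPPos ⇒ E2`: time-ordered test functions are positive-time and off-diagonal. -/
theorem isReflectionPositive_of_rpPos {S₁ : SchwingerFamily E4} (h : RPPos S₁) :
    S₁.toLabelled.IsReflectionPositive := by
  intro N deg lab F hF H hH
  exact h N deg F (fun j => (hF j).isPositiveTimeMulti) (fun j => (hF j).isOffDiagonal) H hH

end Summit.QuantumFields.YangMills.Cruxes.OSLegsFromFemtoAndGap.DlrCollarTransfer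

end
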